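import Summits.QuantumFields.YangMills.Theorems.BalabanUVNodesPortS1Sect5Beta
import Summits.QuantumFields.YangMills.Theorems.BalabanUVNodesN09NestingOfHierAxial

/-!
# NODE O port, row PT-A-2 S5 — THE TWO NESTING ROWS OF THE §5-AT-THE-RECORD FILES ARE [B7] PROP. 2 (53) THEOREMS UNDER NUMERICS: «`V^{(j)}(W) ∈ domAlt_j`» and
# «`Ū^k U_{k+1}(W) ∈ domAlt_k`» for `W ∈ domAlt_{j+1}` (resp. `domAlt_{k+1}`) follow from [B11] EXISTENCE on the domains and the numerics of dag-n21-c ∕ dag-n09's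
# `N09NestingOfHierAxial` (`C₀(d)ε ≤ ⅓`, `2ε ≤ 2δ_N∕((d+4)L)²`, `2ε ≤ ε₀L²`); hence the §5 bundle, (5.9) and the β-letters at the record from [B11] + (F7a) + (F7a-supp) + (I19) +
# numerics + the displayed analytic inputs (`PolLimitExists`, `C²` at `0`, (5.10))

CITATION HEADER.  [I] = [Balaban1987RG1]: (2.3) p. 265, (2.9) p. 266, (1.2) p. 260, §5 pp. 292–298; [B7] = [Balaban1985Averaging] Prop. 2 (53) p. 26; [B11] = [Balaban1985Variational] Thm 1 p. 279.
Porter PT-A-2 (`ymgap-nodeO-port-PTA-2`), `--supports stmt-QuantumFields-27930 --as helper`.  REUSED BY NAME: `N09NestingOfHierAxial.{hcrit_of_ukExists, iterUk_mem_domAlt_of_ukExists}`,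
`…Sect5Ward.carve25Hyp_recordPlimAx_of_rows`, `…Sect5Beta.{abs_betaOfRecord₁₃Ax_le_betaPrime_of_rows}`.
WHAT IS PROVED (0 sorry, 0 def): `nestings_of_numerics` (the two nesting rows from [B11] existence + numerics), ★★ `carve25Hyp_recordPlimAx_of_rows₂` (the §5 bundle at the record with
the nesting rows DISCHARGED), ★ `abs_betaOfRecord₁₃Ax_le_betaPrime_of_rows₂`, ★★ `betaUpperH_betaOfRecord₁₃Ax_of_rows₂` (p. 264 «uniformly bounded» on the β-box from [B11] on the domains,
(F7a), (F7a-supp), (I19), numerics, `PolLimitExists`, `C²` at `0`, (5.10)).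
HONEST FRAMING.  Bookkeeping; the numerics are hypotheses on `θ.ν.εreg`, `θ.εbg = a₀`, `θ.ν.ε₀` and `L` (not evaluated here); nothing of Bałaban's estimates asserted, ported or discharged;
27930 signed-open (⁸-Ax-LR4), no claim held; finite 𝕋⁴ at fixed ε — NOT continuum∕OS∕Clay; the Yang–Mills mass gap is NOT proved by any of this.
-/

noncomputable section

open scoped Matrix.Norms.L2Operator Topology

namespace Summit.QuantumFields.YangMills.Theorems.BalabanUVNodesPortS1

open Filter MeasureTheory
open Literature.MathematicalPhysics.QuantumFieldTheory.Balaban1983to89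
open Literature.MathematicalPhysics.QuantumFieldTheory.Balaban1983to89.Node00
open Literature.MathematicalPhysics.QuantumFieldTheory.Balaban1983to89.ExpMeanLog (deltaSU)
open T4Continuum (T4Family)
open Summit.QuantumFields.YangMills.Theorems.K0RecordFormatNames
open B12PolarizationTensor120 (expChart)
open B12Sec2to5 (Decay510 betaPrime510)
open FederbushMean (deltaFed)
open Summit.QuantumFields.YangMills.BalabanUVNodes.N09NestingOfHierAxial (hcrit_of_ukExists iterUk_mem_domAlt_of_ukExists)

variable (F : T4Family) (a₀ ε₂₉ : ℝ)

/-- **THE TWO NESTING ROWS FROM [B11] EXISTENCE + NUMERICS** ([B7] Prop. 2 (53) at NODE 00's averaging, dag-n21-c ∕ dag-n09): for `W ∈ domAlt_{j+1}` solvable at radius `ν.εreg`,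
`V^{(j)}(W) = Ū^j U_{j+1}(W) ∈ domAlt_j`; for `W ∈ domAlt_{k+1}` solvable at radius `ε`, `Ū^k U_{k+1}(W) ∈ domAlt_k` — under `0 < ε`, `C₀(d)ε ≤ ⅓`, `2ε ≤ 2δ_N∕((d+4)L)²`, `2ε ≤ ε₀L²`
for `ε ∈ {ν.εreg, ε}`. [cite: Balaban1985Averaging, Prop. 2 (53) p.26; Balaban1987RG1, (2.3) p.265, (1.2) p.260] -/
theorem nestings_of_numerics (θ₀ : Stage13Params F 2) (K k : ℕ) {ε : ℝ}
    (hεreg : 0 < θ₀.ν.εreg) (hreg3 : (143 * (((((F.P K).d + 4 : ℕ) : ℝ)) ^ 2 / 4) ^ 2) * θ₀.ν.εreg ≤ 1 / 3)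
    (hreg2 : 2 * θ₀.ν.εreg ≤ 2 * deltaSU (Fin 2) / ((((F.P K).d + 4) * (F.P K).L : ℕ) : ℝ) ^ 2) (hregε₀ : 2 * θ₀.ν.εreg ≤ θ₀.ν.ε₀ * ((F.P K).L : ℝ) ^ 2)
    (hε : 0 < ε) (hbg3 : (143 * (((((F.P K).d + 4 : ℕ) : ℝ)) ^ 2 / 4) ^ 2) * ε ≤ 1 / 3)
    (hbg2 : 2 * ε ≤ 2 * deltaSU (Fin 2) / ((((F.P K).d + 4) * (F.P K).L : ℕ) : ℝ) ^ 2) (hbgε₀ : 2 * ε ≤ θ₀.ν.ε₀ * ((F.P K).L : ℝ) ^ 2)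
    (h11 : ∀ j < k + 1, ∀ W ∈ domAltOfRecord F 2 θ₀.ν K (j + 1), UkExists F 2 K (j + 1) θ₀.ν.εreg W ∧ UniqueUkOrbit F 2 K (j + 1) θ₀.ν.εreg W)
    (htop : ∀ W ∈ domAltOfRecord F 2 θ₀.ν K (k + 1), UkExists F 2 K (k + 1) ε W ∧ UniqueUkOrbit F 2 K (k + 1) ε W) :
    (∀ j < k + 1, ∀ W ∈ domAltOfRecord F 2 θ₀.ν K (j + 1), critCfgOfRecord F 2 θ₀.ν K j W ∈ domAltOfRecord F 2 θ₀.ν K j) ∧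
      ∀ W ∈ domAltOfRecord F 2 θ₀.ν K (k + 1),
        Averaging.iter (avOfRecord F 2 K) k (Uk F 2 K (k + 1) ε W) ∈ domAltOfRecord F 2 θ₀.ν K k ∧ UkExists F 2 K (k + 1) ε W ∧ UniqueUkOrbit F 2 K (k + 1) ε W :=
  ⟨fun j hj W hW => (mem_domAltOfRecord_iff F 2 θ₀.ν K j _).2 (hcrit_of_ukExists θ₀.ν hεreg hreg3 hreg2 hregε₀ (h11 j hj W hW).1),
    fun W hW => ⟨iterUk_mem_domAlt_of_ukExists θ₀.ν hε hbg3 hbg2 hbgε₀ (htop W hW).1 (Nat.lt_succ_self k), htop W hW⟩⟩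

/-- **★★ [I] §5's BUNDLE AT THE RECORD WITH THE NESTING ROWS DISCHARGED**: `B12Carve25Sect5TensorHyp.Hyp` for a family of the record's limiting kernels from [B11] on the domains
(radius `ν.εreg`, levels `≤ k+1`) and at radius `θ.εbg` on `domAlt_{k+1}`, (F7a), (F7a-supp), (I19), the NUMERICS (on `ν.ε₀`, `ν.εreg`, `εbg`, `L`; all large `K`), `PolLimitExists`,
`C²` at `0`, and the decay (5.10). [cite: Balaban1987RG1, (5.6)-(5.10) pp.292-293, (2.3) p.265; Balaban1985Variational, Thm 1 p.279; Balaban1985Averaging, Prop. 2 (53) p.26] -/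
theorem carve25Hyp_recordPlimAx_of_rows₂ {ι' : Type*} (kOf : ι' → ℕ) (vOf : (i : ι') → Fin (kOf i + 1) → ℝ) {C δ₁ : ℝ} (hδ : 0 < δ₁)
    (h510 : ∀ (i : ι') (μ ν : Fin 4), Decay510 (recordPlimAx F a₀ ε₂₉ (kOf i) (vOf i) μ ν) C δ₁)
    (hε₀ : 0 < (thetaFill F a₀ ε₂₉).ν.ε₀) (hεreg : 0 < (thetaFill F a₀ ε₂₉).ν.εreg) (hεbg : 0 < (thetaFill F a₀ ε₂₉).εbg)
    (hlim : letI θ := thetaFill F a₀ ε₂₉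
      letI := θ.instVβ₁; letI := θ.instVβ₂; letI := θ.instιβ
      ∀ i : ι', PolLimitExists F (kOf i + 1) (fun K => recordTermsAx F a₀ ε₂₉ (kOf i) (vOf i) K) θ.ρ8 θ.bV)
    (hC2 : letI θ := thetaFill F a₀ ε₂₉
      letI := θ.instVβ₁; letI := θ.instVβ₂
      ∀ i : ι', ∀ᶠ K in atTop, ContDiffAt ℝ 2 (expChart (recordTermsAx F a₀ ε₂₉ (kOf i) (vOf i) K) θ.ρ8) 0)
    (hrows : letI θ := thetaFill F a₀ ε₂₉
      ∀ i : ι', ∀ᶠ K in atTop, kOf i + 1 ≤ K ∧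
        (((((F.P K).d * (F.P K).L : ℕ) : ℝ)) ^ 2 / 4 * θ.ν.ε₀ < deltaFed (Fin 2) ∧
          (143 * (((((F.P K).d + 4 : ℕ) : ℝ)) ^ 2 / 4) ^ 2) * θ.ν.εreg ≤ 1 / 3 ∧
          2 * θ.ν.εreg ≤ 2 * deltaSU (Fin 2) / ((((F.P K).d + 4) * (F.P K).L : ℕ) : ℝ) ^ 2 ∧ 2 * θ.ν.εreg ≤ θ.ν.ε₀ * ((F.P K).L : ℝ) ^ 2 ∧
          (143 * (((((F.P K).d + 4 : ℕ) : ℝ)) ^ 2 / 4) ^ 2) * θ.εbg ≤ 1 / 3 ∧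
          2 * θ.εbg ≤ 2 * deltaSU (Fin 2) / ((((F.P K).d + 4) * (F.P K).L : ℕ) : ℝ) ^ 2 ∧ 2 * θ.εbg ≤ θ.ν.ε₀ * ((F.P K).L : ℝ) ^ 2) ∧
        (∀ j < kOf i + 1, ∀ W ∈ domAltOfRecord F 2 θ.ν K (j + 1), UkExists F 2 K (j + 1) θ.ν.εreg W ∧ UniqueUkOrbit F 2 K (j + 1) θ.ν.εreg W) ∧
        (∀ j < kOf i + 1, domAltOfRecord F 2 θ.ν K (j + 1) ⊆
          regSetOfRecord F 2 K j (betaInputOfRecord F 2 (TβOfRecord₁₃ F 2) (chiβOfRecord₁₃Ax F 2 θ) K (T4FlagMemory.extd (vOf i)) j)) ∧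
        (∀ j < kOf i + 1, ∀ᵐ U ∂(fieldMeasure (F.P K) j (SU 2)), (avOfRecord F 2 K j).avg U ∈ domAltOfRecord F 2 θ.ν K (j + 1) →
          U ∉ domAltOfRecord F 2 θ.ν K j → chiβOfRecord₁₃Ax F 2 θ K (T4FlagMemory.extd (vOf i)) j U = 0) ∧
        (∀ j < kOf i + 1, Integrable (betaInputOfRecord F 2 (TβOfRecord₁₃ F 2) (chiβOfRecord₁₃Ax F 2 θ) K (T4FlagMemory.extd (vOf i)) j) (fieldMeasure (F.P K) j (SU 2))) ∧
        (∀ W ∈ domAltOfRecord F 2 θ.ν K (kOf i + 1), UkExists F 2 K (kOf i + 1) θ.εbg W ∧ UniqueUkOrbit F 2 K (kOf i + 1) θ.εbg W)) :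
    B12Carve25Sect5TensorHyp.Hyp (fun i : ι' => recordPlimAx F a₀ ε₂₉ (kOf i) (vOf i)) C δ₁ := by
  letI θ := thetaFill F a₀ ε₂₉
  refine carve25Hyp_recordPlimAx_of_rows F a₀ ε₂₉ kOf vOf hδ h510 hε₀ hlim hC2 fun i => (hrows i).mono fun K hK => ?_
  obtain ⟨hk, ⟨hFed, hreg3, hreg2, hregε₀, hbg3, hbg2, hbgε₀⟩, h11, hF7a, hsupp, hint, htop⟩ := hK
  obtain ⟨hcrit, htop'⟩ := nestings_of_numerics F θ K (kOf i) hεreg hreg3 hreg2 hregε₀ hεbg hbg3 hbg2 hbgε₀ h11 htop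
  exact ⟨hk, hFed, h11, hcrit, hF7a, hsupp, hint, htop'⟩

/-- **★ `|β_{k+1}(v)| ≤ β′` AT ONE MEMBER OF THE β-BOX WITH THE NESTING ROWS DISCHARGED.** [cite: Balaban1987RG1, p.264 (β-clause), (5.42) p.297, (5.10) p.293, (2.3) p.265] -/
theorem abs_betaOfRecord₁₃Ax_le_betaPrime_of_rows₂ (k : ℕ) (v : Fin (k + 1) → ℝ) (hv : v ∈ FlowStep.Box (1 / 2) k) {C δ₁ : ℝ} (hδ : 0 < δ₁)
    (h510 : ∀ μ ν : Fin 4, Decay510 (recordPlimAx F a₀ ε₂₉ k v μ ν) C δ₁)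
    (hε₀ : 0 < (thetaFill F a₀ ε₂₉).ν.ε₀) (hεreg : 0 < (thetaFill F a₀ ε₂₉).ν.εreg) (hεbg : 0 < (thetaFill F a₀ ε₂₉).εbg)
    (hlim : letI θ := thetaFill F a₀ ε₂₉
      letI := θ.instVβ₁; letI := θ.instVβ₂; letI := θ.instιβ
      PolLimitExists F (k + 1) (fun K => recordTermsAx F a₀ ε₂₉ k v K) θ.ρ8 θ.bV)
    (hC2 : letI θ := thetaFill F a₀ ε₂₉
      letI := θ.instVβ₁; letI := θ.instVβ₂
      ∀ᶠ K in atTop, ContDiffAt ℝ 2 (expChart (recordTermsAx F a₀ ε₂₉ k v K) θ.ρ8) 0)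
    (hrows : letI θ := thetaFill F a₀ ε₂₉
      ∀ᶠ K in atTop, k + 1 ≤ K ∧
        (((((F.P K).d * (F.P K).L : ℕ) : ℝ)) ^ 2 / 4 * θ.ν.ε₀ < deltaFed (Fin 2) ∧
          (143 * (((((F.P K).d + 4 : ℕ) : ℝ)) ^ 2 / 4) ^ 2) * θ.ν.εreg ≤ 1 / 3 ∧
          2 * θ.ν.εreg ≤ 2 * deltaSU (Fin 2) / ((((F.P K).d + 4) * (F.P K).L : ℕ) : ℝ) ^ 2 ∧ 2 * θ.ν.εreg ≤ θ.ν.ε₀ * ((F.P K).L : ℝ) ^ 2 ∧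
          (143 * (((((F.P K).d + 4 : ℕ) : ℝ)) ^ 2 / 4) ^ 2) * θ.εbg ≤ 1 / 3 ∧
          2 * θ.εbg ≤ 2 * deltaSU (Fin 2) / ((((F.P K).d + 4) * (F.P K).L : ℕ) : ℝ) ^ 2 ∧ 2 * θ.εbg ≤ θ.ν.ε₀ * ((F.P K).L : ℝ) ^ 2) ∧
        (∀ j < k + 1, ∀ W ∈ domAltOfRecord F 2 θ.ν K (j + 1), UkExists F 2 K (j + 1) θ.ν.εreg W ∧ UniqueUkOrbit F 2 K (j + 1) θ.ν.εreg W) ∧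
        (∀ j < k + 1, domAltOfRecord F 2 θ.ν K (j + 1) ⊆
          regSetOfRecord F 2 K j (betaInputOfRecord F 2 (TβOfRecord₁₃ F 2) (chiβOfRecord₁₃Ax F 2 θ) K (T4FlagMemory.extd v) j)) ∧
        (∀ j < k + 1, ∀ᵐ U ∂(fieldMeasure (F.P K) j (SU 2)), (avOfRecord F 2 K j).avg U ∈ domAltOfRecord F 2 θ.ν K (j + 1) →
          U ∉ domAltOfRecord F 2 θ.ν K j → chiβOfRecord₁₃Ax F 2 θ K (T4FlagMemory.extd v) j U = 0) ∧
        (∀ j < k + 1, Integrable (betaInputOfRecord F 2 (TβOfRecord₁₃ F 2) (chiβOfRecord₁₃Ax F 2 θ) K (T4FlagMemory.extd v) j) (fieldMeasure (F.P K) j (SU 2))) ∧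
        (∀ W ∈ domAltOfRecord F 2 θ.ν K (k + 1), UkExists F 2 K (k + 1) θ.εbg W ∧ UniqueUkOrbit F 2 K (k + 1) θ.εbg W)) :
    |betaOfRecord₁₃Ax F 2 (thetaFill F a₀ ε₂₉) k v| ≤ betaPrime510 4 C δ₁ := by
  letI θ := thetaFill F a₀ ε₂₉
  have hT := taylorData3_recordPlimAx_betaOfRecord₁₃Ax a₀ ε₂₉ (fun _ : Unit => k) (fun _ => v)
    (carve25Hyp_recordPlimAx_of_rows₂ F a₀ ε₂₉ (fun _ : Unit => k) (fun _ => v) hδ (fun _ => h510) hε₀ hεreg hεbg (fun _ => hlim) (fun _ => hC2) (fun _ => hrows))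
    () hv 0 1
  have h := B12Ineq544Constant.norm_beta_le_betaPrime hδ (h510 0 1) hT (show (0 : Fin 4) ≠ 1 by decide)
  rwa [Complex.norm_real, Real.norm_eq_abs] at h

/-- **★★ p. 264 «UNIFORMLY BOUNDED» AS `FlowStep.BetaUpperH β′ ½ β` AT THE RECORD WITH THE NESTING ROWS DISCHARGED** — from [B11] on the domains, (F7a), (F7a-supp), (I19), numerics,
`PolLimitExists`, `C²` at `0` and (5.10), each read at every member of the β-box. [cite: Balaban1987RG1, p.264 (β-clause after (1.22)), (5.42) p.297, (5.10) p.293; Balaban1985Variational, Thm 1 p.279] -/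
theorem betaUpperH_betaOfRecord₁₃Ax_of_rows₂ {C δ₁ : ℝ} (hδ : 0 < δ₁)
    (h510 : ∀ (k : ℕ) (v : Fin (k + 1) → ℝ), v ∈ FlowStep.Box (1 / 2) k → ∀ μ ν : Fin 4, Decay510 (recordPlimAx F a₀ ε₂₉ k v μ ν) C δ₁)
    (hε₀ : 0 < (thetaFill F a₀ ε₂₉).ν.ε₀) (hεreg : 0 < (thetaFill F a₀ ε₂₉).ν.εreg) (hεbg : 0 < (thetaFill F a₀ ε₂₉).εbg)
    (hlim : letI θ := thetaFill F a₀ ε₂₉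
      letI := θ.instVβ₁; letI := θ.instVβ₂; letI := θ.instιβ
      ∀ (k : ℕ) (v : Fin (k + 1) → ℝ), v ∈ FlowStep.Box (1 / 2) k → PolLimitExists F (k + 1) (fun K => recordTermsAx F a₀ ε₂₉ k v K) θ.ρ8 θ.bV)
    (hC2 : letI θ := thetaFill F a₀ ε₂₉
      letI := θ.instVβ₁; letI := θ.instVβ₂
      ∀ (k : ℕ) (v : Fin (k + 1) → ℝ), v ∈ FlowStep.Box (1 / 2) k → ∀ᶠ K in atTop, ContDiffAt ℝ 2 (expChart (recordTermsAx F a₀ ε₂₉ k v K) θ.ρ8) 0)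
    (hrows : letI θ := thetaFill F a₀ ε₂₉
      ∀ (k : ℕ) (v : Fin (k + 1) → ℝ), v ∈ FlowStep.Box (1 / 2) k → ∀ᶠ K in atTop, k + 1 ≤ K ∧
        (((((F.P K).d * (F.P K).L : ℕ) : ℝ)) ^ 2 / 4 * θ.ν.ε₀ < deltaFed (Fin 2) ∧
          (143 * (((((F.P K).d + 4 : ℕ) : ℝ)) ^ 2 / 4) ^ 2) * θ.ν.εreg ≤ 1 / 3 ∧
          2 * θ.ν.εreg ≤ 2 * deltaSU (Fin 2) / ((((F.P K).d + 4) * (F.P K).L : ℕ) : ℝ) ^ 2 ∧ 2 * θ.ν.εreg ≤ θ.ν.ε₀ * ((F.P K).L : ℝ) ^ 2 ∧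
          (143 * (((((F.P K).d + 4 : ℕ) : ℝ)) ^ 2 / 4) ^ 2) * θ.εbg ≤ 1 / 3 ∧
          2 * θ.εbg ≤ 2 * deltaSU (Fin 2) / ((((F.P K).d + 4) * (F.P K).L : ℕ) : ℝ) ^ 2 ∧ 2 * θ.εbg ≤ θ.ν.ε₀ * ((F.P K).L : ℝ) ^ 2) ∧
        (∀ j < k + 1, ∀ W ∈ domAltOfRecord F 2 θ.ν K (j + 1), UkExists F 2 K (j + 1) θ.ν.εreg W ∧ UniqueUkOrbit F 2 K (j + 1) θ.ν.εreg W) ∧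
        (∀ j < k + 1, domAltOfRecord F 2 θ.ν K (j + 1) ⊆
          regSetOfRecord F 2 K j (betaInputOfRecord F 2 (TβOfRecord₁₃ F 2) (chiβOfRecord₁₃Ax F 2 θ) K (T4FlagMemory.extd v) j)) ∧
        (∀ j < k + 1, ∀ᵐ U ∂(fieldMeasure (F.P K) j (SU 2)), (avOfRecord F 2 K j).avg U ∈ domAltOfRecord F 2 θ.ν K (j + 1) →
          U ∉ domAltOfRecord F 2 θ.ν K j → chiβOfRecord₁₃Ax F 2 θ K (T4FlagMemory.extd v) j U = 0) ∧
        (∀ j < k + 1, Integrable (betaInputOfRecord F 2 (TβOfRecord₁₃ F 2) (chiβOfRecord₁₃Ax F 2 θ) K (T4FlagMemory.extd v) j) (fieldMeasure (F.P K) j (SU 2))) ∧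
        (∀ W ∈ domAltOfRecord F 2 θ.ν K (k + 1), UkExists F 2 K (k + 1) θ.εbg W ∧ UniqueUkOrbit F 2 K (k + 1) θ.εbg W)) :
    FlowStep.BetaUpperH (betaPrime510 4 C δ₁) (1 / 2) (betaOfRecord₁₃Ax F 2 (thetaFill F a₀ ε₂₉)) := fun k v hv =>
  (le_abs_self _).trans (abs_betaOfRecord₁₃Ax_le_betaPrime_of_rows₂ F a₀ ε₂₉ k v hv hδ (h510 k v hv) hε₀ hεreg hεbg (hlim k v hv) (hC2 k v hv) (hrows k v hv))

end Summit.QuantumFields.YangMills.Theorems.BalabanUVNodesPortS1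

end
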